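import Literature.AnabelianGeometry.SemiGraphs.TieBijectiveGeneral
import Literature.AnabelianGeometry.SemiGraphs.CoverticialRemark241OfGeneralTie

/-!
# [SemiAnbd] Remark 2.4.1 along finite étale coverings — discharged (FACT-LIST F-1478)

Mochizuki, *Semi-graphs of anabelioids*, Publ. RIMS **42** (2006) 221–322, §2, Remark 2.4.1 p. 26: "if
`𝒢′ → 𝒢` is a finite étale covering, `v′` a vertex of `𝒢′` over `v`, `e′` an edge over `e`, then it is
immediate from the definitions [Def. 2.4 (i)(ii)] that elevated `v` implies elevated `v′`, universally
sub-coverticial `e` implies universally sub-coverticial `e′`; similarly aloof / estranged pass to the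
covering" [cite: MochizukiSemiAnbd2006, Rem. 2.4.1 p.26].

PROOF-ONLY (abc-iut cell, layer L3; FACT-LIST row F-1478; seat abc-iut-f-161).  The named fact
`remark_2_4_1_covering` of `Coverticial.lean` (abc-iut-L3-t1) holds AS TYPED: abc-iut-w5-d041's
conditional closer `remark_2_4_1_covering_of_tie` (`CoverticialRemark241OfGeneralTie.lean`, resting on
print's finite étale coverings composing — Route W, GAP-LEDGER G-w5d041-g4-1 isolated as its one
binder) applied to abc-iut-f-161's `Hom.tie_bijective_general` (the tie WITHOUT connectedness
hypotheses, `TieBijectiveGeneral.lean`).  Nothing here takes a side on [IUTchIII] Cor. 3.12; typed ≠ the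
print sentence beyond what `remark_2_4_1_covering` states.
-/

namespace Literature.AnabelianGeometry.SemiGraphs

universe v₁ u₁ u

namespace SemiGraphOfAnabelioids

/-- **[SemiAnbd] Remark 2.4.1 along finite étale coverings holds as typed** (FACT-LIST F-1478
`remark_2_4_1_covering`, [SemiAnbd] Rem. 2.4.1 p. 26): along a finite étale covering `φ : 𝒢′ → 𝒢`
(`Hom.IsFiniteEtaleCoveringGlobal`), elevated vertices, universally sub-coverticial edges, aloof edges
and estranged edges of `𝒢` pull back to such of `𝒢′`.  Proof: `remark_2_4_1_covering_of_tie`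
(abc-iut-w5-d041) and `Hom.tie_bijective_general` (the tie without connectedness hypotheses).
[cite: MochizukiSemiAnbd2006, Rem. 2.4.1 p.26] -/
theorem remark_2_4_1_covering_holds :
    Literature.AnabelianGeometry.SemiGraphs.SemiGraphOfAnabelioids.remark_2_4_1_covering.{v₁, u₁, u} :=
  remark_2_4_1_covering_of_tie fun ψ A _ αψ _ eψ hloc hal hva => by
    obtain ⟨O, OE, h1, h2, h3, h4, -⟩ := Hom.tie_bijective_general ψ A αψ eψ hloc hal hva
    exact ⟨O, OE, h1, h2, h3, h4⟩

end SemiGraphOfAnabelioids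

end Literature.AnabelianGeometry.SemiGraphs
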